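import Literature.InformationTheory.QuantumCodes.DepolarizingCSSDecoding
import Literature.InformationTheory.QuantumCodes.CSSThresholdConverses
import HarnessLib

/-!
# Sector-wise decoding under depolarizing noise: the converse bounds (`P^depol(p) ≥ P^Z(2p/3)`,
# `P^depol(p) ≥ P^X(2p/3)`; threshold `≤ 3/8` for every pair of sector decoders)

Topic `Literature/InformationTheory/QuantumCodes` (venture QEC, LADDER-QEC rung Q5; qec-lit-2 gen 4). The tree's
`DepolarizingCSSDecoding.lean` (qec-type-09) decodes a CSS code SECTOR-WISE under i.i.d. depolarizing noise of rate
`p` («we have separate procedures for recovery from the X errors and the Z errors», Dennis–Kitaev–Landahl–Preskill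
§4.1) and proves the UNION BOUND `P^depol(p) ≤ P^X(2p/3) + P^Z(2p/3)` from the exact marginals (each part of a
depolarizing error is a pattern of independent flips of rate `2p/3`, `sum_depolarizingProb_zBit_mem`). This file
PROVES the other direction and its threshold consequences (kernel axioms; no named fact; no definition):

* `CSSCode.zFailure_le_depolarizingFailureProb`, `CSSCode.xFailure_le_depolarizingFailureProb` — failure of one
  sector implies failure of the sector-wise recovery, so `P^Z_{2p/3}[D_Z fails] ≤ P^depol_p` and
  `P^X_{2p/3}[D_X fails] ≤ P^depol_p` (`0 ≤ p ≤ 1`); hence `max ≤ P^depol ≤ sum` together with type-09's bound.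
* `CSSCode.quarter_le_depolarizingFailureProb` — for a CSS code with `k ≥ 1` and ANY pair of sector decoders,
  `1/4 ≤ P^depol_{3/8}` (at `p = 3/8` both marginals have rate `1/4`, and `P^Z_{1/4} + P^X_{1/4} ≥ 1/2` by the
  code-capacity converse `CSSCode.half_le_zFailure_add_xFailure`); `CSSCode.half_le_depolarizingFailureProb` —
  `1/2 ≤ P^depol_{3/4}` (at the completely depolarizing point the phase-flip marginal has rate `1/2`).
* families with `k ≥ 1` throughout (written out so that they are definitionally the census families
  `depolarizingFailureFamily` / `zFailureFamily` / `xFailureFamily` of `Summits/Ventures/QEC/Thresholds/`):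
  `depolarizing_threshold_le_three_eighths` (every certified depolarizing threshold lower bound for sector-wise
  decoding is `≤ 3/8`), and the TRANSFER `isThresholdLowerBound_zFailure_of_depolarizing` /
  `isThresholdLowerBound_xFailure_of_depolarizing`: a certified depolarizing threshold lower bound `a` certifies
  `2a/3` as a code-capacity threshold lower bound for EACH sector — the converse of the tree's `3/2` rule, so that
  (Summits side) `p_c^depol = (3/2)·min(p_c^X, p_c^Z)` EXACTLY for sector-wise decoding.

HONEST FRAMING: statements about SECTOR-WISE decoder pairs `(D_X, D_Z)` (the class for which the tree's
depolarizing thresholds are stated); a correlation-aware decoder of depolarizing noise is not covered. Nothing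
here is a Monte Carlo number; the hashing-bound value `≈ .189` is not a theorem of the tree.

## References

* [DennisEtAl2002] E. Dennis, A. Kitaev, A. Landahl, J. Preskill, J. Math. Phys. 43 (2002) 4452, §4.1 (depolarizing
  channel vs. independent `X`/`Z` errors; separate recovery procedures).
* [DumerKovalevPryadko2015] I. Dumer, A. A. Kovalev, L. P. Pryadko, PRL 115 (2015) 050502, eq.
  (succesful-decoding-depolarizing) (CSS decoding succeeds iff both residuals are trivial).
* [RichardsonUrbanke2008] T. Richardson, R. Urbanke, *Modern Coding Theory*, Lemma 4.78 (Erasure Decomposition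
  Lemma) — via `CSSThresholdConverses.lean`.
-/

noncomputable section

namespace Literature.InformationTheory.QuantumCodes

open Finset Filter Topology Literature.Computability.QuantumComplexity

namespace CSSCode

variable {RX RZ Q : Type*} [Fintype Q] [DecidableEq Q] [Fintype RX] [Fintype RZ]

open Classical in
/-- **`P^Z_{2p/3}[D_Z fails] ≤ P^depol_p`**: if the phase-flip part is decoded wrongly the sector-wise recovery
fails; the phase-flip part of a depolarizing error is a pattern of independent flips of rate `2p/3`.
[cite: DennisEtAl2002, §4.1 (separate recovery from X and Z errors)] [cite: DumerKovalevPryadko2015, eq. (succesful-decoding-depolarizing)] -/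
theorem zFailure_le_depolarizingFailureProb (C : CSSCode RX RZ Q) (DX : Decoder (RZ → ZMod 2) (Q → ZMod 2))
    (DZ : Decoder (RX → ZMod 2) (Q → ZMod 2)) {p : ℝ} (hp0 : 0 ≤ p) (hp1 : p ≤ 1) :
    ∑ z ∈ univ.filter (fun z : Q → ZMod 2 => ¬ DZ.Corrects C.zSyndrome (C.rowSpZ : Set (Q → ZMod 2)) z),
        bernoulliWeight (2 * p / 3) (supp z) ≤ C.depolarizingFailureProb DX DZ p := by
  rw [← sum_depolarizingProb_zBit_mem p
    (univ.filter (fun z : Q → ZMod 2 => ¬ DZ.Corrects C.zSyndrome (C.rowSpZ : Set (Q → ZMod 2)) z)),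
    depolarizingFailureProb]
  refine Finset.sum_le_sum_of_subset_of_nonneg ?_ (fun E _ _ => depolarizingProb_nonneg hp0 hp1 E)
  intro E hE
  simp only [mem_filter, mem_univ, true_and] at hE ⊢
  exact fun h => hE h.2

open Classical in
/-- **`P^X_{2p/3}[D_X fails] ≤ P^depol_p`** (bit-flip part). [cite: DennisEtAl2002, §4.1 (separate recovery from X and Z errors)] [cite: DumerKovalevPryadko2015, eq. (succesful-decoding-depolarizing)] -/
theorem xFailure_le_depolarizingFailureProb (C : CSSCode RX RZ Q) (DX : Decoder (RZ → ZMod 2) (Q → ZMod 2))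
    (DZ : Decoder (RX → ZMod 2) (Q → ZMod 2)) {p : ℝ} (hp0 : 0 ≤ p) (hp1 : p ≤ 1) :
    ∑ x ∈ univ.filter (fun x : Q → ZMod 2 => ¬ DX.Corrects C.xSyndrome (C.rowSpX : Set (Q → ZMod 2)) x),
        bernoulliWeight (2 * p / 3) (supp x) ≤ C.depolarizingFailureProb DX DZ p := by
  rw [← sum_depolarizingProb_xBit_mem p
    (univ.filter (fun x : Q → ZMod 2 => ¬ DX.Corrects C.xSyndrome (C.rowSpX : Set (Q → ZMod 2)) x)),
    depolarizingFailureProb]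
  refine Finset.sum_le_sum_of_subset_of_nonneg ?_ (fun E _ _ => depolarizingProb_nonneg hp0 hp1 E)
  intro E hE
  simp only [mem_filter, mem_univ, true_and] at hE ⊢
  exact fun h => hE h.1

/-- **At `p = 3/8` every sector-wise decoder pair fails with probability `≥ 1/4`** (`k ≥ 1`): both marginals have
flip rate `1/4`, and `P^Z_{1/4}[D_Z fails] + P^X_{1/4}[D_X fails] ≥ 1/2` (code-capacity converse).
[cite: RichardsonUrbanke2008, Lemma 4.78 (Erasure Decomposition Lemma); DennisEtAl2002, §4.1] -/
theorem quarter_le_depolarizingFailureProb (C : CSSCode RX RZ Q) (hk : 0 < C.k)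
    (DX : Decoder (RZ → ZMod 2) (Q → ZMod 2)) (DZ : Decoder (RX → ZMod 2) (Q → ZMod 2)) :
    1 / 4 ≤ C.depolarizingFailureProb DX DZ (3 / 8) := by
  have hZ := C.zFailure_le_depolarizingFailureProb DX DZ (p := 3 / 8) (by norm_num) (by norm_num)
  have hX := C.xFailure_le_depolarizingFailureProb DX DZ (p := 3 / 8) (by norm_num) (by norm_num)
  have h := C.half_le_zFailure_add_xFailure hk DZ DX (p := 2 * (3 / 8) / 3) (p' := 2 * (3 / 8) / 3)
    (by norm_num) (by norm_num) (by norm_num)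
  linarith

/-- **At the completely depolarizing point `p = 3/4` every sector-wise decoder pair fails with probability
`≥ 1/2`** (`k ≥ 1`; the phase-flip marginal has rate `1/2`). [cite: DennisEtAl2002, §4.1 (depolarizing channel)] -/
theorem half_le_depolarizingFailureProb (C : CSSCode RX RZ Q) (hk : 0 < C.k)
    (DX : Decoder (RZ → ZMod 2) (Q → ZMod 2)) (DZ : Decoder (RX → ZMod 2) (Q → ZMod 2)) :
    1 / 2 ≤ C.depolarizingFailureProb DX DZ (3 / 4) := by
  have hZ := C.zFailure_le_depolarizingFailureProb DX DZ (p := 3 / 4) (by norm_num) (by norm_num)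
  have h := C.half_le_zFailure_half hk DZ
  norm_num at hZ h
  linarith

end CSSCode

/-! ### Families: `p₀^depol ≤ 3/8`, and a depolarizing floor certifies sector floors at `2/3` the rate -/

section Thresholds

variable {RX RZ Q : ℕ → Type*} [∀ i, Fintype (Q i)] [∀ i, DecidableEq (Q i)] [∀ i, Fintype (RX i)]
  [∀ i, Fintype (RZ i)]

/-- **Every certified depolarizing threshold lower bound for sector-wise decoding is `≤ 3/8`** (family of CSS
codes with `k ≥ 1`, ANY sector decoder families). [cite: DennisEtAl2002, §4.1; RichardsonUrbanke2008, Lemma 4.78] -/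
theorem depolarizing_threshold_le_three_eighths (C : ∀ i, CSSCode (RX i) (RZ i) (Q i)) (hk : ∀ i, 0 < (C i).k)
    (DX : ∀ i, Decoder (RZ i → ZMod 2) (Q i → ZMod 2)) (DZ : ∀ i, Decoder (RX i → ZMod 2) (Q i → ZMod 2))
    {a : ℝ} (ha : IsThresholdLowerBound (fun i p => (C i).depolarizingFailureProb (DX i) (DZ i) p) a) :
    a ≤ 3 / 8 := by
  by_contra h
  push Not at h
  exact not_belowThreshold_of_le (c := 1 / 4) (by norm_num)
    (fun i => (C i).quarter_le_depolarizingFailureProb (hk i) (DX i) (DZ i)) (ha (3 / 8) (by norm_num) h)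

/-- **Accuracy-threshold form**: `p_c^depol ≤ 3/8` for sector-wise decoding of any family of CSS codes with
`k ≥ 1`. [cite: DennisEtAl2002, §4.1 and §4.6 (p_c)] -/
theorem depolarizing_accuracyThreshold_le_three_eighths (C : ∀ i, CSSCode (RX i) (RZ i) (Q i))
    (hk : ∀ i, 0 < (C i).k) (DX : ∀ i, Decoder (RZ i → ZMod 2) (Q i → ZMod 2))
    (DZ : ∀ i, Decoder (RX i → ZMod 2) (Q i → ZMod 2)) :
    accuracyThreshold (fun i p => (C i).depolarizingFailureProb (DX i) (DZ i) p) ≤ 3 / 8 :=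
  depolarizing_threshold_le_three_eighths C hk DX DZ (isThresholdLowerBound_accuracyThreshold _)

open Classical in
/-- **Transfer to the `Z`-sector**: a certified depolarizing threshold lower bound `a` (sector-wise decoding by
`(D_X, D_Z)`) certifies `2a/3` as a code-capacity threshold lower bound for the phase-flip sector decoded by `D_Z`
(for `r < 2a/3`, `P^Z_r ≤ P^depol_{3r/2} → 0`). [cite: DennisEtAl2002, §4.1 (depolarizing channel vs. independent Z errors)] -/
theorem isThresholdLowerBound_zFailure_of_depolarizing (C : ∀ i, CSSCode (RX i) (RZ i) (Q i))
    (hk : ∀ i, 0 < (C i).k) (DX : ∀ i, Decoder (RZ i → ZMod 2) (Q i → ZMod 2))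
    (DZ : ∀ i, Decoder (RX i → ZMod 2) (Q i → ZMod 2)) {a : ℝ}
    (ha : IsThresholdLowerBound (fun i p => (C i).depolarizingFailureProb (DX i) (DZ i) p) a) :
    IsThresholdLowerBound (fun i r => ∑ z ∈ univ.filter (fun z : Q i → ZMod 2 =>
        ¬ (DZ i).Corrects (C i).zSyndrome ((C i).rowSpZ : Set (Q i → ZMod 2)) z), bernoulliWeight r (supp z))
      (2 * a / 3) := by
  intro r hr0 hra
  have ha38 := depolarizing_threshold_le_three_eighths C hk DX DZ ha
  have hp1 : 3 * r / 2 ≤ 1 := by linarith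
  have hdep : Tendsto (fun i => (C i).depolarizingFailureProb (DX i) (DZ i) (3 * r / 2)) atTop (𝓝 0) :=
    ha (3 * r / 2) (by linarith) (by linarith)
  refine squeeze_zero (fun i => Finset.sum_nonneg fun z _ => bernoulliWeight_nonneg hr0 (by linarith) _)
    (fun i => ?_) hdep
  have h := (C i).zFailure_le_depolarizingFailureProb (DX i) (DZ i) (p := 3 * r / 2) (by linarith) hp1
  have hr : 2 * (3 * r / 2) / 3 = r := by ring
  rw [hr] at h
  exact h

open Classical in
/-- **Transfer to the `X`-sector**: `2a/3` is a code-capacity threshold lower bound for the bit-flip sector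
decoded by `D_X`. [cite: DennisEtAl2002, §4.1 (depolarizing channel vs. independent X errors)] -/
theorem isThresholdLowerBound_xFailure_of_depolarizing (C : ∀ i, CSSCode (RX i) (RZ i) (Q i))
    (hk : ∀ i, 0 < (C i).k) (DX : ∀ i, Decoder (RZ i → ZMod 2) (Q i → ZMod 2))
    (DZ : ∀ i, Decoder (RX i → ZMod 2) (Q i → ZMod 2)) {a : ℝ}
    (ha : IsThresholdLowerBound (fun i p => (C i).depolarizingFailureProb (DX i) (DZ i) p) a) :
    IsThresholdLowerBound (fun i r => ∑ x ∈ univ.filter (fun x : Q i → ZMod 2 =>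
        ¬ (DX i).Corrects (C i).xSyndrome ((C i).rowSpX : Set (Q i → ZMod 2)) x), bernoulliWeight r (supp x))
      (2 * a / 3) := by
  intro r hr0 hra
  have ha38 := depolarizing_threshold_le_three_eighths C hk DX DZ ha
  have hp1 : 3 * r / 2 ≤ 1 := by linarith
  have hdep : Tendsto (fun i => (C i).depolarizingFailureProb (DX i) (DZ i) (3 * r / 2)) atTop (𝓝 0) :=
    ha (3 * r / 2) (by linarith) (by linarith)
  refine squeeze_zero (fun i => Finset.sum_nonneg fun x _ => bernoulliWeight_nonneg hr0 (by linarith) _)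
    (fun i => ?_) hdep
  have h := (C i).xFailure_le_depolarizingFailureProb (DX i) (DZ i) (p := 3 * r / 2) (by linarith) hp1
  have hr : 2 * (3 * r / 2) / 3 = r := by ring
  rw [hr] at h
  exact h

end Thresholds

end Literature.InformationTheory.QuantumCodes

end
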